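import Summits.CriticalPhenomena.PercolationContinuityZ3.Theses.PercNonProliferation
import Summits.CriticalPhenomena.PercolationContinuityZ3.Theorems.SubpolynomialBlocking.Negative.OffCritical
import Summits.CriticalPhenomena.PercolationContinuityZ3.Theorems.SubpolynomialBlocking.Negative.Strengthenings
import Literature.Probability.Percolation.SlabCriticality
import Literature.Probability.Percolation.HalfSpacePinnedPairs
import Literature.Probability.Percolation.SubgraphMonotonicity
import Literature.Probability.Percolation.SharpnessDCTProofs
import Literature.Probability.Percolation.HalfSpaceLemma752
import Literature.Barriers.CriticalPhenomena.SlabLimitUniformControl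
import Summits.CriticalPhenomena.PercolationContinuityZ3.Theorems.PercNonProliferationSubpolynomialBlockingStubSlabTransfer
import Summits.CriticalPhenomena.PercolationContinuityZ3.Theorems.PercNonProliferationSubpolynomialBlockingStubCruxIffCurtainSubpoly

/-!
# Line `slab-ladder-two-curtains` — checked skeleton for the crux `SubpolynomialBlocking`
# (stmt-CriticalPhenomena-4446, route `PercNonProliferation`, rank 4)

Crux (fixed, by name): `PercNonProliferation.SubpolynomialBlocking` —
`∀ s > 0, ∀ᶠ n, n^{-s} ≤ u_n`, `u_n := P_{p_c(ℤ³)}(B(n) ↮ ∂ⁱⁿB(2n) inside B(2n))` (`blockEv n`).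

RESHAPE (lead c2, prover-line-stmt-CriticalPhenomena-4446-c2-0, 2026-08-16) of the planner's
checked skeleton `Lines/slab-ladder-two-curtains.lean` — same composition idea (two curtains +
Harris + monotone climb to `p_c(S_{4n})` + transfer to the slab), stub set changed as follows
(all three registered with `workitem stub-add`, signatures spelled out in tree vocabulary):
* `stub_slabTransfer` (stub 1, unchanged in content, KNOWN; M) — the `ℤ³`-probability of the
  centred curtain IS the slab probability of NTW's blocking event in `S_{4n}`.
* `stub_slabCriticalBlockingSubpoly` (stub 2, OPEN, hardest, the lead's) — REPLACES the
  planner's `stub_scaleRestrictedSlabCriterion`. It is exactly what the composition consumes: at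
  the TIED scale `k = 4n` only, in BLOCKING form,
  `∀ s > 0, ∀ᶠ n, n^{-s} ≤ P^{S_{4n}}_{p_c(S_{4n})}(B̄_n ↮ ∂B̄_{2n} inside B̄_{2n})`.
  It is WEAKER than the criterion form (`stub2_of_scaleRestrictedSlabCriterion`, PROVED below
  from `criticalExclusion`): no all-scales `n ≥ k/4` burden (where a `k`-uniform control of the
  quasi-planar regime `n ≫ k` would be a universality statement of its own), no criterion
  dressing; by the honesty lemma `criterion_of_blocking` nothing the ladder uses is lost.
* `stub_cruxIffCurtainSubpoly` (stub 3, provable now from landed lemmas; M) — the NECESSITY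
  picture of the line: the same curtain bound AT `p = p_c(ℤ³)` is EQUIVALENT to the crux
  (`⇐`: `curtain_sq_le_block`; `⇒`: four face-slab seals make a curtain, Harris `V_n⁴ ≤ κ_n`,
  tiling `stub_tiling` p80188 and `stub_cruxIffSeedSubpoly` p86229). Hence the ONLY content of
  stub 2 beyond the crux itself is the monotone climb `p_c → p_c(S_{4n})` (`curtain_antitone`):
  stub 2 = "the curtain form of the crux, asserted at the slab's own critical point", where a
  same-`p` finite-size criterion and `θ(p_c(S_k)) = 0` are theorems (NTW 2017, DST 2016).
The composition `SubpolynomialBlocking_of : stub 1 → stub 2 → crux` is re-proved below (shorter: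
`n^{-s} = (n^{-s/2})² ≤ κ_n(p_c(S_{4n}))² ≤ κ_n(p_c)² ≤ u_n`); the planner's `ladder`,
`criticalExclusion`, `criterion_of_blocking` are kept as the bridge from any future CRITERION
proof (NTW Lemma 3.11 re-run with scale-dependent constants) to stub 2.

THE LINE (idea card `Ideas/slab-ladder-two-curtains.md`; triage r1-1/2/3 all `pass`; sharpened
as the panel asked — T2: "restate C⁺ with the constant AT SCALE ≥ k/4 only … a scale-restricted
Lemma 3.11", T3: "C⁺ ⇔ the slab criterion's threshold ε₀(k) ≥ k^{-o(1)}", T1: "the engine is a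
same-p contact/gluing statement at scale ≍ thickness; the slab dressing buys exactly one tool: a
same-p finite-size criterion + openness in p"). Blocking is a DECREASING event, so the critical
blocking probability of `ℤ³` is bounded BELOW by the blocking probability of the slab
`S_{4n} = {0 ≤ x₀ ≤ 4n}` at ITS OWN (larger) critical point, where Newman–Tassion–Wu 2017 (§3,
Lemma 3.11 + Lemma 3.13 + Cor. 3.2 (4)) provide a same-`p` FINITE-SIZE CRITERION whose threshold
`c₁(k)` is, by the openness-in-`p` argument of their Lemma 3.13, a lower bound for critical slab
blocking. Two orthogonal full-thickness slab curtains enclose `B(n)` (no caps), Harris squares: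

  `u_n(p_c) ≥ κ_n(p_c)² ≥ κ_n(p_c(S_{4n}))² = P_{S_{4n},p_c(S_{4n})}[B̄_n ↮ ∂B̄_{2n}]² ≥ c₁(4n)²`,

so the crux follows from `c₁(k) ≥ k^{-o(1)}` — the whole open content is the `k`-DEPENDENCE of
ONE Newman–Tassion–Wu threshold at horizontal scale `≍ k/4` (NTW, Remark after Thm 3.1: "the
sequence `(c_ρ(k))` converges quickly to `0` … Getting better bounds would be very interesting").

* `harris_two_curtains` (PROVED here: Harris–FKG `harris_fkg_lower` for the two decreasing
  measurable local events + the deterministic inclusion `two_curtains_subset`, all `ω`, all `n`):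
  `P_p(curtain0 n) · P_p(curtain2 n) ≤ P_p(blockEv n)` for every `p`, `n`.
* `curtainSymmetry` (PROVED here: invariance of `P_p` under the lattice automorphism
  `σ : x ↦ (x₂, x₁, x₀)` of `ℤ³` — `zdSignedPermIso`, `bondPercolation_real_preimage_relabel_iso`,
  `relabel_mem_openConnIn_iff` — which exchanges the two curtains): `P_p(curtain2 n) = P_p(curtain0 n)`;
  whence `curtain_sq_le_block : P_p(curtain0 n)² ≤ P_p(blockEv n)` (PROVED).
* `stub_slabTransfer` (stub 1, KNOWN — translation invariance of `P_p` (Grimmett 1999 §1.6) + the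
  restriction coupling `P_p^{ℤ³} ∘ restrict⁻¹ = P_p^{S_k}` (`bondPercolation_map_comap`); M): the
  `ℤ³`-probability of the centred curtain `curtain0 n ⊆ 2^{E(B(2n))}` IS the slab probability of
  NTW's blocking event `(B̄_n ↮ ∂B̄_{2n})` in `S_{4n}` (tree vocabulary `slabConn`, `sqBox`,
  `sqSphere` of `SlabCriticality.lean`).
* `criticalExclusion` (PROVED here, not a stub — NTW Lemma 3.13's mechanism, p. 15: "the set
  `{p : ∃ n, f_p > 1-c₁}` is open and does not intersect `[0, p_c(S_k))`, thus `p_c` does not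
  belong to this set"; continuity of local-event probabilities
  `continuous_bondPercolation_real_of_determinedBy` + `determinedBy_slabConn`, `p_c(S_k) > 0`,
  `criticalProb_le_of_theta_pos`, `le_of_forall_pos_lt_le`): a finite-size criterion with
  threshold `c` at one scale forces crossing probability `≤ 1 - c` AT `p_c(S_k)` — using neither
  `θ(p_c(S_k)) = 0` nor anything critical.
* `stub_scaleRestrictedSlabCriterion` (stub 2, OPEN — the transfer target C⁺ in the panel's
  sharpened form; the hardest stub; XL): a SCALE-RESTRICTED Newman–Tassion–Wu criterion with
  SUB-POLYNOMIAL threshold: `∃ c₁ : ℕ → ℝ`, `c₁(k) ≥ k^{-s}` eventually for every `s > 0`, such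
  that for all `k ≤ 4n`, `n ≥ 1`, all `p`: `P_{S_k,p}[B̄_n ↔ ∂B̄_{2n}] > 1 - c₁(k) ⇒ θ_{S_k}(p) > 0`.
  For each FIXED `k` and SOME `c₁(k) > 0` this is, in substance, NTW 2017 §3 (annulus crossing
  forces a short-way crossing of an aspect-ratio-4 rectangle, §3.8; square-root trick Cor 3.4;
  near-certain easy crossings force near-certain hard ones, proof of Thm 3.17 with Prop 3.9; then
  the finite criterion Lemma 3.11, scales `n ≥ 4r = 12`); the printed `c₁(k)` is a tower in `k` (gluing function `h₁(1-δ) = 1 - C₂(k)/log|log δ|`,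
  `C₂(k) = (2/ε)^{|B̄_{r+2}|}`, `|B̄_{r+2}| ≍ k`, iterated `ℓ ≍ log(1/η)/c'(k)` times). The rate
  `k^{-o(1)}` at scales `≥ k/4` is where `d = 3` must enter (see "Disproof honoured").
* `ladder` (PROVED, graded): for ANY threshold `c ≥ 0` validating the criterion at `k = 4n`,
  `c² ≤ u_n(p_c)` — so a merely exponential threshold `c₁(k) ≥ e^{-Ck}` already gives
  `u_n ≥ e^{-8Cn}`, beating the only floor in print/tree `(1-p_c)^{|∂_E Λ_n|} = e^{-Θ(n²)}`
  (`Negative.Strengthenings.pow_card_edgeBoundary_le_blockProb`), and a polynomial threshold gives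
  the first polynomial lower bound on critical blocking in `ℤ³` (neither closes THIS crux, whose
  `∀ s` form needs `k^{-o(1)}`; recorded for the route planner, cf. MEMO-ideator1g2 §2).
* `SubpolynomialBlocking_of : Stubs.stub_slabTransfer → Stubs.stub_scaleRestrictedSlabCriterion →
  SubpolynomialBlocking` (the stub `Prop`s BY NAME), PROVED (no `sorry`): `ladder` at `k = 4n`
  with `c = c₁(4n)`, the eventuality in `k` pulled back along `n ↦ 4n`, and
  `n^{-s} ≤ ((4n)^{-s/4})²` for `n ≥ 4`.
* `SubpolynomialBlocking_proof : SubpolynomialBlocking` from the two sorried stubs — the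
  skeleton IS the crux proof once the sorries are discharged (D-0027 §3.3 shape). Two stubs is
  the honest count: every other joint of the line is PROVED in this file, and the internal joints
  of stub 2 (near-contact lemma, switching inequality, NTW §3 re-run with scale-dependent
  constants) need definitions (minimal paths/circuits, contact counts) and an unvalidated proof
  architecture — they are `--supports` lemmas for the lead, listed in the line card, not stubs.
* Proved infrastructure: `two_curtains_subset` (all `ω`, all `n`: `B(n) ⊆ column0 ∩ column2`,
  `∂ⁱⁿB(2n) ⊆ lateral0 ∪ lateral2`), `curtain_antitone` (blocking is decreasing in `p`),
  `pc_le_pcSlab` (`p_c(ℤ³) ≤ p_c(S_k)`), measurability, `criterion_of_blocking` (honesty lemma: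
  at a single scale the criterion with threshold `c` is EQUIVALENT, given `criticalExclusion`,
  to critical blocking `≥ c` — the multi-scale stub with ONE threshold and a RATE is the
  genuine criterion), `threshold_sq_lt_one` (calibration against `Negative.Strengthenings`).

Disproof.lean (cdisprove cycle 1, `Cruxes/SubpolynomialBlocking/Disproof.lean`; landed as
`Theorems/SubpolynomialBlocking/Negative/{OffCritical,AboveSix,Strengthenings}`, imported here)
honoured — there is no `_false_without_` theorem by that name; its two LOAD-BEARING findings are:
§2 `Negative.not_subpolynomialBlockingAt_of_criticalProb_lt` (any proof must use `p ≤ p_c`): used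
exactly at `curtain_antitone ∘ pc_le_pcSlab` inside `ladder` (`κ_n(p_c) ≥ κ_n(p_c(S_{4n}))` needs
`p_c ≤ p_c(S_{4n})`; for `p > p_c`, `p ≤ p_c(S_{4n})` fails for large `n` by Grimmett–Marstrand, so
the skeleton proves nothing above `p_c`, as it must); §4 `Negative.not_subpolynomialBlockingAt_
criticalProb_above_six` (a `d ≤ 6` input is needed): it enters ONLY through the RATE in
`stub_scaleRestrictedSlabCriterion` — the criterion SHAPE holds for the quasi-planar slabs
`ℤ² × G`, `G` finite, in any dimension with some `c₁ > 0` (DST 2016 §1 "Two generalizations";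
NTW Def. 3.1 "general `r`"), so the rate `k^{-o(1)}` is the `d = 3` statement. §6 refuted
strengthenings (`not_uniform_in_s`, `not_forall_n`, `not_exponent_zero`): the composition yields
`∀ s, ∀ᶠ n` with an `s`-dependent threshold `N(s)` (from the `s/4`-rate and `n ≥ 4`), never the
uniform or `n ≥ 1` forms. §7b: ratio 2 throughout. No stub is an instance of a landed Negative
lemma: stub 1 is an identity of product measures valid at every `p`; stub 2 is a criterion at
every `p` whose only critical consequence concerns `p_c(S_k)`, `k < ∞` (where `θ = 0` is a
theorem, DST 2016), never `p_c(ℤ³)` directly.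
-/

noncomputable section

open MeasureTheory Filter Topology
open Literature.Probability.Percolation Literature.Probability.LatticeModels

namespace Summit.CriticalPhenomena.PercolationContinuityZ3.Cruxes.SubpolynomialBlocking.SlabLadderTwoCurtains

/-! ## Vocabulary: the crux's event, the two curtains, the slab and NTW's blocking event -/

/-- Bond percolation on `ℤ³` at parameter `p`. -/
abbrev μ (p : unitInterval) : Measure (BondConfig (Site 3)) := bondPercolation (zdGraph 3) p

/-- Bond percolation on the slab `S_k = {0 ≤ x₀ ≤ k}` (induced subgraph) at parameter `p`. -/
abbrev μS (k : ℕ) (p : unitInterval) : Measure (BondConfig (slab 3 k)) :=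
  bondPercolation (slabGraph 3 k) p

/-- The crux's blocking event `Block_n = {no open path inside B(2n) from B(n) to ∂ⁱⁿB(2n)}`
(verbatim the set in `PercNonProliferation.SubpolynomialBlocking`). -/
def blockEv (n : ℕ) : Set (BondConfig (Site 3)) :=
  {ω | ¬ ∃ x ∈ box 3 n, ∃ y ∈ innerBoundary (zdGraph 3) (box 3 (2 * n)),
      ω ∈ openConnIn ↑(box 3 (2 * n)) x y}

/-- The crux, verbatim, is `∀ s > 0, ∀ᶠ n, n^{-s} ≤ μ_{p_c}(Block_n)` (definitional). -/
theorem crux_iff :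
    Theses.PercNonProliferation.SubpolynomialBlocking ↔
      ∀ s : ℝ, 0 < s → ∀ᶠ n : ℕ in atTop, (n : ℝ) ^ (-s) ≤ (μ (criticalProbI 3)).real (blockEv n) :=
  Iff.rfl

/-- The full-height column of horizontal half-width `n` around coordinate axis `0` inside
`B(2n)`: `{|v₁| ≤ n, |v₂| ≤ n} ∩ B(2n)` (NTW's `B̄_n` in the slab `{|v₀| ≤ 2n} ≅ S_{4n}`). -/
def column0 (n : ℕ) : Set (Site 3) :=
  {v | v ∈ box 3 (2 * n) ∧ |v 1| ≤ (n : ℤ) ∧ |v 2| ≤ (n : ℤ)}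

/-- Its lateral boundary inside `B(2n)`: `max(|v₁|,|v₂|) = 2n` (NTW's `∂B̄_{2n}`). -/
def lateral0 (n : ℕ) : Set (Site 3) :=
  {v | v ∈ box 3 (2 * n) ∧ (|v 1| = 2 * (n : ℤ) ∨ |v 2| = 2 * (n : ℤ))}

/-- CURTAIN around the `0`-column: no open path inside `B(2n)` from the column to its lateral
boundary — NTW 2017 Cor. 3.2 (4)'s event "`B̄_n ↮ ∂B̄_{2n}`" in the slab `{|v₀| ≤ 2n}` of
thickness `4n + 1`, read on `ℤ³`-configurations (it depends only on the edges of `B(2n)`). -/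
def curtain0 (n : ℕ) : Set (BondConfig (Site 3)) :=
  {ω | ¬ ∃ x ∈ column0 n, ∃ y ∈ lateral0 n, ω ∈ openConnIn ↑(box 3 (2 * n)) x y}

/-- The same objects with coordinate `2` as the thickness direction. -/
def column2 (n : ℕ) : Set (Site 3) :=
  {v | v ∈ box 3 (2 * n) ∧ |v 0| ≤ (n : ℤ) ∧ |v 1| ≤ (n : ℤ)}

/-- Lateral boundary of the `2`-column. -/
def lateral2 (n : ℕ) : Set (Site 3) :=
  {v | v ∈ box 3 (2 * n) ∧ (|v 0| = 2 * (n : ℤ) ∨ |v 1| = 2 * (n : ℤ))}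

/-- Curtain around the `2`-column. -/
def curtain2 (n : ℕ) : Set (BondConfig (Site 3)) :=
  {ω | ¬ ∃ x ∈ column2 n, ∃ y ∈ lateral2 n, ω ∈ openConnIn ↑(box 3 (2 * n)) x y}

/-- The critical point of the slab `S_k` (rooted at the origin), as a point of `[0,1]`. -/
def pcSlab (k : ℕ) : unitInterval := criticalProbIOf (slabGraph 3 k) (slabOrigin 3 k)

/-- NTW's annulus-CROSSING event in the slab `S_k` at horizontal scale `n`: "there exists an open
path from `B̄_n` to `∂B̄_{2n}`" inside `B̄_{2n}` (`B_m = [-m,m]²`; tree vocabulary of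
`SlabCriticality.lean`: `X ⟷^B Y = slabConn k B X Y`). Its complement is the blocking event of
NTW 2017, Cor. 3.2 (4). -/
def slabCross (k n : ℕ) : Set (BondConfig (slab 3 k)) :=
  slabConn k (sqBox (0 : ℤ × ℤ) (2 * n)) (sqBox (0 : ℤ × ℤ) n) (sqSphere (0 : ℤ × ℤ) (2 * n))

/-- `slabCross` is measurable (a local event). -/
theorem measurableSet_slabCross (k n : ℕ) : MeasurableSet (slabCross k n) :=
  measurableSet_slabConn k _ _ _ _

/-! ## The two registered stubs: precise `Prop`s `Stubs.stub_*` + sorried theorems `stub_*`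

D-0027 §3.3 shape: `SubpolynomialBlocking_of` takes the two `Stubs.stub_*` `Prop`s BY NAME;
each `theorem stub_* : <Stubs.stub_* spelled out> := by sorry` is the registered stub; and
`SubpolynomialBlocking_proof` applies `_of` to the two theorems (the application type-checks by
unfolding, so the spelled-out signatures cannot drift from the `Prop`s). -/

namespace Stubs

/-- **Stub `Prop` 1 (`SlabTransfer`)** — KNOWN (translation + restriction coupling; M). -/
def stub_slabTransfer : Prop :=
  ∀ (p : unitInterval) (n : ℕ), (μ p).real (curtain0 n) = (μS (4 * n) p).real (slabCross (4 * n) n)ᶜ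

/-- **Stub `Prop` 2 (`SlabCriticalBlockingSubpoly`)** — OPEN, the transfer target at the TIED
scale (hardest; XL): NTW's annulus-blocking event of the slab `S_{4n}` at horizontal scale `n`,
at the slab's OWN critical point, has probability `≥ n^{-s}` eventually, for every `s > 0`. -/
def stub_slabCriticalBlockingSubpoly : Prop :=
  ∀ s : ℝ, 0 < s → ∀ᶠ n : ℕ in atTop,
    (n : ℝ) ^ (-s) ≤ (μS (4 * n) (pcSlab (4 * n))).real (slabCross (4 * n) n)ᶜ

/-- **Stub `Prop` 3 (`CruxIffCurtainSubpoly`)** — provable now (M): the curtain form of the crux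
AT `p_c(ℤ³)` is equivalent to the crux. -/
def stub_cruxIffCurtainSubpoly : Prop :=
  Theses.PercNonProliferation.SubpolynomialBlocking ↔
    ∀ s : ℝ, 0 < s → ∀ᶠ n : ℕ in atTop, (n : ℝ) ^ (-s) ≤ (μ (criticalProbI 3)).real (curtain0 n)

/-- The planner's original stub 2 (`ScaleRestrictedSlabCriterion`), kept as a `Prop` (NOT a
registered stub any more): a scale-restricted NTW finite-size criterion with sub-polynomial
threshold. It IMPLIES the registered stub 2 (`stub2_of_scaleRestrictedSlabCriterion`). -/
def scaleRestrictedSlabCriterion : Prop :=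
  ∃ c₁ : ℕ → ℝ, (∀ s : ℝ, 0 < s → ∀ᶠ k : ℕ in atTop, (k : ℝ) ^ (-s) ≤ c₁ k) ∧
    ∀ (k n : ℕ) (p : unitInterval), 1 ≤ n → k ≤ 4 * n →
      1 - c₁ k < (μS k p).real (slabCross k n) → 0 < theta (slabGraph 3 k) (slabOrigin 3 k) p

end Stubs

/-- **stub 1 (registered) = `Stubs.stub_slabTransfer` spelled out in tree vocabulary — THE
CURTAIN IS NTW's SLAB EVENT.** For every `p` and `n`:
`P_p^{ℤ³}(curtain0 n) = P_p^{S_{4n}}((slabCross (4n) n)ᶜ)`.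
KNOWN, size M: shift by `2n·e₀` (`bondPercolation_real_preimage_shift`; `B(2n) + 2n e₀ =`
the lift `{0 ≤ x₀ ≤ 4n} × B_{2n}` of `sqBox 0 (2n)`, `column0 ↦` lift of `sqBox 0 n`, `lateral0 ↦`
lift of `sqSphere 0 (2n)` since inside `B_{2n}`, `|x₁| = 2n ∨ |x₂| = 2n ⟺ max(|x₁|,|x₂|) = 2n`),
then the restriction coupling along `Subtype.val : slab 3 (4n) → Site 3`
(`bondPercolation_map_comap`, `restrictConfig`; `slabGraph = induce = comap val`): an open path of
`ℤ³` inside a region contained in the slab is an open path of the restricted slab configuration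
and conversely (graph isomorphism of the two induced open graphs, valid for ALL `ω`, so the two
EVENTS correspond exactly under `restrictConfig val ∘ shift`, and the measures correspond by the
two push-forward identities). Sources: Grimmett 1999 §1.6 (p. 16) and §7.2 (p. 148, `p_c(A)`);
NewmanTassionWu2017 Cor 3.2 (4) (the event). CANDIDATE PROOF: `Lines/slab-ladder-two-curtains-
SlabTransferProof.lean` (planner; rc 0, 0 sorry). -/
theorem stub_slabTransfer :
    ∀ (p : unitInterval) (n : ℕ),
      (bondPercolation (zdGraph 3) p).real
          {ω | ¬ ∃ x ∈ {v : Site 3 | v ∈ box 3 (2 * n) ∧ |v 1| ≤ (n : ℤ) ∧ |v 2| ≤ (n : ℤ)},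
            ∃ y ∈ {v : Site 3 | v ∈ box 3 (2 * n) ∧ (|v 1| = 2 * (n : ℤ) ∨ |v 2| = 2 * (n : ℤ))},
              ω ∈ openConnIn (↑(box 3 (2 * n)) : Set (Site 3)) x y} =
        (bondPercolation (slabGraph 3 (4 * n)) p).real
          (slabConn (4 * n) (sqBox (0 : ℤ × ℤ) (2 * n)) (sqBox (0 : ℤ × ℤ) n)
            (sqSphere (0 : ℤ × ℤ) (2 * n)))ᶜ :=
  -- LANDED p99917 (worker, wave 1): `Theorems/PercNonProliferationSubpolynomialBlockingStubSlabTransfer.lean`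
  Theorems.SubpolynomialBlocking.stub_slabTransfer

/-- **stub 2 (registered) = `Stubs.stub_slabCriticalBlockingSubpoly` spelled out in tree
vocabulary — CRITICAL SLAB BLOCKING AT THE TIED SCALE IS SUB-POLYNOMIAL.** For every `s > 0`,
eventually in `n`: `n^{-s} ≤ P^{S_{4n}}_{p_c(S_{4n})}(B̄_n ↮ ∂B̄_{2n} inside B̄_{2n})`, the
annulus-BLOCKING event of Newman–Tassion–Wu 2017, Cor. 3.2 (4), for the slab
`S_{4n} = {0 ≤ x₀ ≤ 4n}` of thickness `4n + 1` at horizontal scale `n`, at the slab's own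
critical point `p_c(S_{4n}) = criticalProb (slabGraph 3 (4n)) (slabOrigin 3 (4n))`.
OPEN, size XL, the hardest stub (the lead's). KNOWN: for each fixed `k`, blocking at `p_c(S_k)`
is `≥ c(k) > 0` at all scales `n ≥ 12` (NTW 2017 Thm 3.1 + Remark, Cor 3.2 (4), via the same-`p`
criterion Lemma 3.11 and the openness step Lemma 3.13 = `criticalExclusion` below); the printed
`c(k)` is a tower in `k` (full-column surgery `|B̄_{r+2}| ≍ k` in Lemma 3.5; near-1 gluing
function `1 - C₂(k)/log|log δ|`), useless at the tied scale `n = k/4` where even the trivial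
floor is `e^{-Θ(k²)}`. WHY PLAUSIBLY TRUE: under standard 3D→2D crossover scaling
(`p_c(S_k) - p_c ≍ k^{-1/ν}`) the box `B̄_{2n} × [0,4n]` at `p_c(S_{4n})` sits at a FIXED rescaled
distance above `p_c(ℤ³)` inside the critical window, so the blocking probability converges to a
positive constant (astronomically small at aspect ratio 2: `u_n(p_c) ≲ 10⁻⁶`, MC-blocking.md).
WHY IT MIGHT FAIL: if the threshold shift `p_c(S_k) - p_c` decayed SLOWER than the window
`k^{-1/ν}`, the box would be supercritical at scale `n ≫ ξ` and blocking stretched-exponentially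
small (`Negative.OffCritical` mechanism); rigorously only `p_c(S_k) ≤ p_c + C/√(log k)` is known
(DuminilcopinKozmaTassion2020). NOT known to be NECESSARY for the crux (it lives at `p > p_c`;
cf. stub 3: its `p = p_c` version IS necessary and sufficient). Where `d = 3` must enter: any
proof needs a same-`p` gluing/contact input at scale `≍` thickness in a critical-window cube
(triage T1 note 2; Barriers `SprinklingRenormalisation`, `TransverseCrossingsNeedNotMeet`).
Sources: NewmanTassionWu2017 (arXiv:1512.09107) Thm 3.1 + Remark, Cor 3.2 (4), Lemma 3.5,
Lemmas 3.11–3.13; DuminilCopinSidoraviciusTassion2016 (arXiv:1401.7130) Thm 1, Lemma 6;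
DuminilcopinKozmaTassion2020; Grimmett1999 Thm (7.2). -/
theorem stub_slabCriticalBlockingSubpoly :
    ∀ s : ℝ, 0 < s → ∀ᶠ n : ℕ in atTop,
      (n : ℝ) ^ (-s) ≤
        (bondPercolation (slabGraph 3 (4 * n))
            (criticalProbIOf (slabGraph 3 (4 * n)) (slabOrigin 3 (4 * n)))).real
          (slabConn (4 * n) (sqBox (0 : ℤ × ℤ) (2 * n)) (sqBox (0 : ℤ × ℤ) n)
            (sqSphere (0 : ℤ × ℤ) (2 * n)))ᶜ := by
  sorry

/-- **stub 3 (registered) = `Stubs.stub_cruxIffCurtainSubpoly` spelled out in tree vocabulary —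
THE CURTAIN FORM OF THE CRUX (necessity picture of the line).** The crux holds iff the centred
curtain of `ℤ³` at `p_c(ℤ³)` is sub-polynomially likely:
`SubpolynomialBlocking ↔ ∀ s > 0, ∀ᶠ n, n^{-s} ≤ P_{p_c}(curtain0 n)`.
`⇐`: `curtain_sq_le_block` (two curtains + Harris + symmetry, this file) and `n^{-s} = (n^{-s/2})²`.
`⇒`: an open path inside `B(2n)` from the column `{|v₁|,|v₂| ≤ n}` to `{|v₁| = 2n ∨ |v₂| = 2n}`
traverses, after its last visit below level `n` in the exit coordinate, one of the FOUR face-slabs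
`{z ∈ B(2n) : n ≤ ±z_i ≤ 2n}`, `i ∈ {1,2}` (`exists_traverse`), so four seals make a curtain
(lattice configurations; cf. `StubSixSlab.not_mem_annulusCrossing` with six); Harris over the four
decreasing seals of common probability `V_n` (`prob_pow_le_biInter_of_isLowerSet`,
`StubSixSlab.real_compl_openCrossing_image`) gives `V_n⁴ ≤ P(curtain0 n)`; and `V_n` is
sub-polynomial under the crux by `stub_cruxIffSeedSubpoly 2` (p86229, `⇒`) and `stub_tiling 2`
(p80188). Size M, provable now. Sources: Grimmett 1999 Thm (2.4), §1.6. -/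
theorem stub_cruxIffCurtainSubpoly :
    (Summit.CriticalPhenomena.PercolationContinuityZ3.Theses.PercNonProliferation.SubpolynomialBlocking ↔
      ∀ s : ℝ, 0 < s → ∀ᶠ n : ℕ in atTop,
        (n : ℝ) ^ (-s) ≤
          (bondPercolation (zdGraph 3) (criticalProbI 3)).real
            {ω | ¬ ∃ x ∈ {v : Site 3 | v ∈ box 3 (2 * n) ∧ |v 1| ≤ (n : ℤ) ∧ |v 2| ≤ (n : ℤ)},
              ∃ y ∈ {v : Site 3 | v ∈ box 3 (2 * n) ∧ (|v 1| = 2 * (n : ℤ) ∨ |v 2| = 2 * (n : ℤ))},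
                ω ∈ openConnIn (↑(box 3 (2 * n)) : Set (Site 3)) x y}) :=
  -- LANDED p101591 (worker, wave 1): `Theorems/PercNonProliferationSubpolynomialBlockingStubCruxIffCurtainSubpoly.lean`
  Theorems.SubpolynomialBlocking.stub_cruxIffCurtainSubpoly

/-- **`CriticalExclusion` — NTW's LEMMA 3.13 MECHANISM (a same-`p` finite-size criterion
excludes the critical point by OPENNESS in `p`)**, PROVED below (`criticalExclusion`), so it is
NOT a stub: if, for the slab `S_k` at horizontal scale `n` and a threshold `c`, crossing
probability `> 1 - c` forces percolation in `S_k` at every parameter, then at `p = p_c(S_k)` the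
crossing probability is `≤ 1 - c` (NewmanTassionWu2017 Lemma 3.13, p. 15: "the set
`{p ∈ (ε,1-ε) : ∃ n ≥ 4r, f_p(2n,n-1) > 1-c₁}` is open and does not intersect `[0, p_c(S_k))`. Thus
`p_c` does not belong to this set"; identical to DST 2016 §2.2's continuity step, in tree as
`DuminilCopinSidoraviciusTassion2016_criticalProb_lt_of_criterion`). Uses NEITHER
`θ(p_c(S_k)) = 0` NOR anything critical: continuity of `p ↦ P_p(slabCross k n)`
(`continuous_bondPercolation_real_of_determinedBy`, `determinedBy_slabConn`), `p_c(S_k) > 0`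
(`pcSlab_pos`), and `θ_{S_k}(q) > 0 ⇒ p_c(S_k) ≤ q` (`criticalProb_le_of_theta_pos`). -/
def CriticalExclusion : Prop :=
  ∀ (k n : ℕ) (c : ℝ),
    (∀ p : unitInterval, 1 - c < (μS k p).real (slabCross k n) →
        0 < theta (slabGraph 3 k) (slabOrigin 3 k) p) →
      (μS k (pcSlab k)).real (slabCross k n) ≤ 1 - c

/-! ## Proved infrastructure I: the deterministic two-curtain inclusion (all `ω`, all `n`) -/

/-- `B(n) ⊆ B(2n)` (pointwise, by `omega`). -/
theorem mem_box_two_mul {n : ℕ} {x : Site 3} (hx : x ∈ box 3 n) : x ∈ box 3 (2 * n) := by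
  rw [mem_box] at hx ⊢
  intro i
  have h := hx i
  push_cast
  omega

/-- `B(n) ⊆ column0 n`. -/
theorem box_subset_column0 {n : ℕ} {x : Site 3} (hx : x ∈ box 3 n) : x ∈ column0 n := by
  refine ⟨mem_box_two_mul hx, ?_, ?_⟩
  · have h := (mem_box.1 hx) 1
    exact abs_le.2 ⟨h.1, h.2⟩
  · have h := (mem_box.1 hx) 2
    exact abs_le.2 ⟨h.1, h.2⟩

/-- `B(n) ⊆ column2 n`. -/
theorem box_subset_column2 {n : ℕ} {x : Site 3} (hx : x ∈ box 3 n) : x ∈ column2 n := by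
  refine ⟨mem_box_two_mul hx, ?_, ?_⟩
  · have h := (mem_box.1 hx) 0
    exact abs_le.2 ⟨h.1, h.2⟩
  · have h := (mem_box.1 hx) 1
    exact abs_le.2 ⟨h.1, h.2⟩

/-- `∂ⁱⁿB(2n) ⊆ lateral2 n ∪ lateral0 n`: a site of the inner boundary of `B(2n)` lies on a face
`{x_i = ±2n}`; the face `i = 0` is lateral for the `2`-column, the faces `i = 1, 2` for the
`0`-column. -/
theorem mem_lateral_of_mem_innerBoundary {n : ℕ} {y : Site 3}
    (hy : y ∈ innerBoundary (zdGraph 3) (box 3 (2 * n))) : y ∈ lateral2 n ∨ y ∈ lateral0 n := by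
  have hyB : y ∈ box 3 (2 * n) := (Finset.mem_filter.1 hy).1
  obtain ⟨i, hi⟩ := exists_eq_of_mem_innerBoundary_box hy
  have habs : |y i| = 2 * (n : ℤ) := by
    have h2 : (0 : ℤ) ≤ 2 * (n : ℤ) := by positivity
    rcases hi with h | h
    · rw [h]; push_cast; exact abs_of_nonneg h2
    · rw [h]; push_cast; rw [abs_neg]; exact abs_of_nonneg h2
  fin_cases i
  · exact Or.inl ⟨hyB, Or.inl habs⟩
  · exact Or.inr ⟨hyB, Or.inl habs⟩
  · exact Or.inr ⟨hyB, Or.inr habs⟩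

/-- **TWO CURTAINS MAKE A SPHERE** (deterministic, every configuration, every `n`): an open path
inside `B(2n)` from `B(n)` to `∂ⁱⁿB(2n)` ends on a face `{x_i = ±2n}`; if `i ∈ {1,2}` it joins
`column0 n ⊇ B(n)` to `lateral0 n`, if `i = 0` it joins `column2 n ⊇ B(n)` to `lateral2 n`. -/
theorem two_curtains_subset (n : ℕ) : curtain0 n ∩ curtain2 n ⊆ blockEv n := by
  rintro ω ⟨h0, h2⟩ ⟨x, hx, y, hy, hxy⟩
  rcases mem_lateral_of_mem_innerBoundary hy with hl | hl
  · exact h2 ⟨x, box_subset_column2 hx, y, hl, hxy⟩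
  · exact h0 ⟨x, box_subset_column0 hx, y, hl, hxy⟩

/-! ## Proved infrastructure II: monotonicity in `p`, measurability, `p_c(ℤ³) ≤ p_c(S_k)` -/

/-- Open-crossing events between arbitrary site sets of a countable graph are measurable. -/
theorem measurableSet_openCrossing_site (S A B : Set (Site 3)) :
    MeasurableSet (openCrossing S A B) := by
  have h : openCrossing S A B = ⋃ x ∈ A, ⋃ y ∈ B, openConnIn S x y := by
    ext ω; simp [openCrossing]
  rw [h]
  exact MeasurableSet.biUnion (Set.to_countable A) fun x _ =>
    MeasurableSet.biUnion (Set.to_countable B) fun y _ => measurableSet_openConnIn_of_countable S x y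

/-- The curtain is the complement of an open-crossing event. -/
theorem curtain0_eq_compl (n : ℕ) :
    curtain0 n = (openCrossing (↑(box 3 (2 * n)) : Set (Site 3)) (column0 n) (lateral0 n))ᶜ := by
  ext ω; simp [curtain0, openCrossing]

/-- The second curtain likewise. -/
theorem curtain2_eq_compl (n : ℕ) :
    curtain2 n = (openCrossing (↑(box 3 (2 * n)) : Set (Site 3)) (column2 n) (lateral2 n))ᶜ := by
  ext ω; simp [curtain2, openCrossing]

/-- The curtain is measurable. -/
theorem measurableSet_curtain0 (n : ℕ) : MeasurableSet (curtain0 n) := by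
  rw [curtain0_eq_compl]; exact (measurableSet_openCrossing_site _ _ _).compl

/-- The curtain is a decreasing event. -/
theorem isLowerSet_curtain0 (n : ℕ) : IsLowerSet (curtain0 n) := by
  rw [curtain0_eq_compl]; exact (isUpperSet_openCrossing _ _ _).compl

/-- The second curtain is measurable. -/
theorem measurableSet_curtain2 (n : ℕ) : MeasurableSet (curtain2 n) := by
  rw [curtain2_eq_compl]; exact (measurableSet_openCrossing_site _ _ _).compl

/-- The second curtain is a decreasing event. -/
theorem isLowerSet_curtain2 (n : ℕ) : IsLowerSet (curtain2 n) := by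
  rw [curtain2_eq_compl]; exact (isUpperSet_openCrossing _ _ _).compl

/-- **TWO CURTAINS MAKE A SPHERE, in probability** (PROVED; Harris–FKG for the two decreasing
measurable events `curtain0 n`, `curtain2 n` — `harris_fkg_lower`, Grimmett 1999 Thm (2.4) —
and the inclusion `two_curtains_subset`): `P_p(curtain0 n) · P_p(curtain2 n) ≤ P_p(Block_n)`. -/
theorem harris_two_curtains (p : unitInterval) (n : ℕ) :
    (μ p).real (curtain0 n) * (μ p).real (curtain2 n) ≤ (μ p).real (blockEv n) :=
  (harris_fkg_lower (zdGraph 3) p (isLowerSet_curtain0 n) (isLowerSet_curtain2 n)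
      (measurableSet_curtain0 n) (measurableSet_curtain2 n)).trans
    (measureReal_mono (two_curtains_subset n))

/-! ## Proved infrastructure III: the coordinate swap `x₀ ↔ x₂` exchanges the two curtains -/

/-- The swap `σ : x ↦ (x₂, x₁, x₀)` (signed permutation with trivial signs), a lattice
automorphism of `ℤ³` (`zdSignedPermIso`). -/
def swap02 : Site 3 ≃ Site 3 := Site.signedPerm (Equiv.swap (0 : Fin 3) 2) 1

@[simp] theorem swap02_apply_zero (x : Site 3) : swap02 x 0 = x 2 := by
  simp [swap02, Site.signedPerm_apply, Equiv.symm_swap, Equiv.swap_apply_left]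

@[simp] theorem swap02_apply_one (x : Site 3) : swap02 x 1 = x 1 := by
  have h : Equiv.swap (0 : Fin 3) 2 1 = 1 := Equiv.swap_apply_of_ne_of_ne (by decide) (by decide)
  simp [swap02, Site.signedPerm_apply, Equiv.symm_swap, h]

@[simp] theorem swap02_apply_two (x : Site 3) : swap02 x 2 = x 0 := by
  simp [swap02, Site.signedPerm_apply, Equiv.symm_swap, Equiv.swap_apply_right]

/-- `σ` preserves the boxes `B(m)`. -/
theorem swap02_mem_box_iff {m : ℕ} (x : Site 3) : swap02 x ∈ box 3 m ↔ x ∈ box 3 m :=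
  signedPerm_mem_box_iff _ _

/-- `σ '' B(m) = B(m)`. -/
theorem swap02_image_box (m : ℕ) : swap02 '' (↑(box 3 m) : Set (Site 3)) = ↑(box 3 m) :=
  signedPerm_image_box _ _ m

/-- `σ x ∈ column2 n ↔ x ∈ column0 n`. -/
theorem swap02_mem_column2_iff (n : ℕ) (x : Site 3) : swap02 x ∈ column2 n ↔ x ∈ column0 n := by
  simp only [column2, column0, Set.mem_setOf_eq, swap02_mem_box_iff, swap02_apply_zero,
    swap02_apply_one]
  tauto

/-- `σ y ∈ lateral2 n ↔ y ∈ lateral0 n`. -/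
theorem swap02_mem_lateral2_iff (n : ℕ) (y : Site 3) : swap02 y ∈ lateral2 n ↔ y ∈ lateral0 n := by
  simp only [lateral2, lateral0, Set.mem_setOf_eq, swap02_mem_box_iff, swap02_apply_zero,
    swap02_apply_one]
  tauto

/-- `σ '' ω ∈ curtain2 n ↔ ω ∈ curtain0 n` (transport of restricted open connections,
`relabel_mem_openConnIn_iff`). -/
theorem preimage_relabel_swap02_curtain2 (n : ℕ) :
    BondConfig.relabel (sym2Equiv swap02) ⁻¹' curtain2 n = curtain0 n := by
  ext ω
  simp only [Set.mem_preimage, curtain2, curtain0, Set.mem_setOf_eq, not_iff_not]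
  constructor
  · rintro ⟨x', hx', y', hy', h⟩
    refine ⟨swap02.symm x', ?_, swap02.symm y', ?_, ?_⟩
    · rw [← swap02_mem_column2_iff, Equiv.apply_symm_apply]; exact hx'
    · rw [← swap02_mem_lateral2_iff, Equiv.apply_symm_apply]; exact hy'
    · rw [← relabel_mem_openConnIn_iff swap02 ω (↑(box 3 (2 * n)) : Set (Site 3))
        (swap02.symm x') (swap02.symm y'), swap02_image_box, Equiv.apply_symm_apply,
        Equiv.apply_symm_apply]
      exact h
  · rintro ⟨x, hx, y, hy, h⟩
    refine ⟨swap02 x, (swap02_mem_column2_iff n x).2 hx, swap02 y,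
      (swap02_mem_lateral2_iff n y).2 hy, ?_⟩
    rw [← swap02_image_box (2 * n)]
    exact (relabel_mem_openConnIn_iff swap02 ω _ x y).2 h

/-- **PROVED — the two curtains are equally likely**: `P_p(curtain2 n) = P_p(curtain0 n)`
(invariance of `P_p` under the lattice automorphism `σ`, Grimmett 1999 §1.6:
`bondPercolation_real_preimage_relabel_iso`). -/
theorem curtainSymmetry (p : unitInterval) (n : ℕ) :
    (μ p).real (curtain2 n) = (μ p).real (curtain0 n) := by
  have h := bondPercolation_real_preimage_relabel_iso
    (zdSignedPermIso (Equiv.swap (0 : Fin 3) 2) 1 : zdGraph 3 ≃g zdGraph 3) p (curtain2 n)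
  rw [← h]
  congr 1
  exact preimage_relabel_swap02_curtain2 n

/-- **PROVED — `P_p(curtain0 n)² ≤ P_p(Block_n)`** (Harris + symmetry + two curtains). -/
theorem curtain_sq_le_block (p : unitInterval) (n : ℕ) :
    (μ p).real (curtain0 n) ^ 2 ≤ (μ p).real (blockEv n) := by
  have h := harris_two_curtains p n
  rw [curtainSymmetry p n] at h
  rw [sq]
  exact h

/-- **Blocking is DECREASING, hence antitone in `p`**: `p ≤ q ⇒ P_q(curtain0 n) ≤ P_p(curtain0 n)`
(`DCT16.real_mono_of_isUpperSet` on the complementary crossing event). This is the step where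
`p ≤ p_c(S_{4n})`, i.e. `p_c(ℤ³) ≤ p_c(S_{4n})`, is consumed (Disproof §2). -/
theorem curtain_antitone (n : ℕ) {p q : unitInterval} (hpq : p ≤ q) :
    (μ q).real (curtain0 n) ≤ (μ p).real (curtain0 n) := by
  have hU := isUpperSet_openCrossing (↑(box 3 (2 * n)) : Set (Site 3)) (column0 n) (lateral0 n)
  have hM := measurableSet_openCrossing_site (↑(box 3 (2 * n)) : Set (Site 3)) (column0 n) (lateral0 n)
  have key := DCT16.real_mono_of_isUpperSet (zdGraph 3) hU hM hpq
  rw [curtain0_eq_compl, measureReal_compl hM, measureReal_compl hM, probReal_univ, probReal_univ]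
  linarith

/-- `p_c(ℤ³) ≤ p_c(S_k)` (induced subgraph; Grimmett 1999 §7.1 (7.1)). -/
theorem pc_le_pcSlab (k : ℕ) : criticalProbI 3 ≤ pcSlab k :=
  Subtype.coe_le_coe.mp
    (criticalProb_le_induce theta_induce_le_holds (zdGraph 3) (slab 3 k) 0 (zero_mem_slab 3 k))

/-- `0 < p_c(S_k)` (since `0 < p_c(ℤ³) ≤ p_c(S_k)`). -/
theorem pcSlab_pos (k : ℕ) : 0 < (pcSlab k : ℝ) :=
  lt_of_lt_of_le (criticalProb_zd_pos 3 (by norm_num)) (Subtype.coe_le_coe.mpr (pc_le_pcSlab k))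

/-- `p ↦ P_p^{S_k}(slabCross k n)` is continuous (a local event: polynomial in `p`). -/
theorem continuous_real_slabCross (k n : ℕ) :
    Continuous fun p : unitInterval => (μS k p).real (slabCross k n) := by
  have hfin := finite_sym2 (slabLift_finite k (sqBox_finite (0 : ℤ × ℤ) (2 * n)))
  have hdet := determinedBy_slabConn k (sqBox (0 : ℤ × ℤ) n) (sqSphere (0 : ℤ × ℤ) (2 * n))
    (subset_rfl : sqBox (0 : ℤ × ℤ) (2 * n) ⊆ sqBox (0 : ℤ × ℤ) (2 * n))
  rw [← hfin.coe_toFinset] at hdet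
  exact continuous_bondPercolation_real_of_determinedBy (slabGraph 3 k) hdet

/-- **PROVED — NTW Lemma 3.13's openness step** (`CriticalExclusion`): a finite-size criterion
with threshold `c` at scale `n` in `S_k` forces `P_{p_c(S_k)}(slabCross k n) ≤ 1 - c`. -/
theorem criticalExclusion : CriticalExclusion := by
  intro k n c hFSC
  refine le_of_forall_pos_lt_le (continuous_real_slabCross k n) (pcSlab_pos k) fun q _ hqlt => ?_
  by_contra hgt
  push Not at hgt
  have hle : criticalProb (slabGraph 3 k) (slabOrigin 3 k) ≤ q :=
    criticalProb_le_of_theta_pos _ _ q (hFSC q hgt)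
  have hpc : (pcSlab k : ℝ) = criticalProb (slabGraph 3 k) (slabOrigin 3 k) := rfl
  linarith

/-! ## Honesty lemma: at the single tied scale the criterion IS the blocking bound -/

/-- The converse direction of `criticalExclusion` is free: a blocking bound `κ ≥ c` at
`p_c(S_k)` gives the criterion with threshold `c` AT THAT SCALE (antitonicity + `p_c ≤ p ⇒ θ > 0`
is not even needed: `P_p(cross) > 1 - c ≥ P_{p_c(S_k)}(cross)` forces `p > p_c(S_k)`). Hence, for a
SINGLE scale, "criterion with threshold `c`" and "critical blocking `≥ c`" are equivalent given
`criticalExclusion` — which is why the lead's reshape registers the BLOCKING form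
`stub_slabCriticalBlockingSubpoly` at the tied scale (the planner's criterion form
`Stubs.scaleRestrictedSlabCriterion` additionally asserted the criterion at ALL scales `n ≥ k/4`
with ONE threshold). Stated here as the implication used nowhere else (documentation of the cut;
proved from monotonicity in `p` of the increasing event `slabCross` and `theta_pos`-above-`p_c`). -/
theorem criterion_of_blocking (k n : ℕ) {c : ℝ}
    (hc : (μS k (pcSlab k)).real (slabCross k n) ≤ 1 - c)
    (hmono : ∀ p q : unitInterval, p ≤ q → (μS k p).real (slabCross k n) ≤ (μS k q).real (slabCross k n))
    (habove : ∀ p : unitInterval, (pcSlab k : ℝ) < p → 0 < theta (slabGraph 3 k) (slabOrigin 3 k) p) :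
    ∀ p : unitInterval, 1 - c < (μS k p).real (slabCross k n) →
      0 < theta (slabGraph 3 k) (slabOrigin 3 k) p := by
  intro p hp
  refine habove p (lt_of_not_ge fun hle => ?_)
  have := hmono p (pcSlab k) (Subtype.coe_le_coe.mp hle)
  linarith

/-! ## The ladder (graded) and the composition -/

/-- **THE LADDER, graded form** (PROVED): if the criterion holds for the slab `S_{4n}` at
horizontal scale `n` with a threshold `c ≥ 0`, then `c² ≤ u_n(p_c(ℤ³))`:
`u_n(p_c) ≥ κ_n(p_c)² ≥ κ_n(p_c(S_{4n}))² = P_{S_{4n},p_c(S_{4n})}(blocked)² ≥ c²`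
(`curtain_sq_le_block`; `curtain_antitone` with `pc_le_pcSlab`; stub 1 `stub_slabTransfer`;
`criticalExclusion`). Any threshold transfers: an
exponential `c = e^{-Ck}` gives `u_n ≥ e^{-8Cn}` (beats the `e^{-Θ(n²)}` floor of
`Negative.Strengthenings.pow_card_edgeBoundary_le_blockProb`), a polynomial one the first
polynomial lower bound on critical blocking in `ℤ³`. -/
theorem ladder (h2 : Stubs.stub_slabTransfer) (n : ℕ) {c : ℝ} (hc : 0 ≤ c)
    (hFSC : ∀ p : unitInterval, 1 - c < (μS (4 * n) p).real (slabCross (4 * n) n) →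
      0 < theta (slabGraph 3 (4 * n)) (slabOrigin 3 (4 * n)) p) :
    c ^ 2 ≤ (μ (criticalProbI 3)).real (blockEv n) := by
  have hA : (μS (4 * n) (pcSlab (4 * n))).real (slabCross (4 * n) n) ≤ 1 - c :=
    criticalExclusion (4 * n) n c hFSC
  have hB : c ≤ (μS (4 * n) (pcSlab (4 * n))).real (slabCross (4 * n) n)ᶜ := by
    rw [probReal_compl_eq_one_sub (measurableSet_slabCross (4 * n) n)]
    linarith
  have hC : c ≤ (μ (pcSlab (4 * n))).real (curtain0 n) := by
    rw [h2 (pcSlab (4 * n)) n]; exact hB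
  have hD : c ≤ (μ (criticalProbI 3)).real (curtain0 n) :=
    hC.trans (curtain_antitone n (pc_le_pcSlab (4 * n)))
  calc c ^ 2 ≤ ((μ (criticalProbI 3)).real (curtain0 n)) ^ 2 := pow_le_pow_left₀ hc hD 2
    _ ≤ (μ (criticalProbI 3)).real (blockEv n) := curtain_sq_le_block (criticalProbI 3) n

/-- Exponent bookkeeping: `n^{-s} ≤ ((4n)^{-s/4})²` for `n ≥ 4` (`(4n)^{-s/2} ≥ (n²)^{-s/2}`). -/
theorem rpow_neg_le_sq {s : ℝ} (hs : 0 < s) {n : ℕ} (hn : 4 ≤ n) :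
    (n : ℝ) ^ (-s) ≤ ((((4 * n : ℕ) : ℝ)) ^ (-(s / 4))) ^ 2 := by
  have hn4 : (4 : ℝ) ≤ n := by exact_mod_cast hn
  have hn0 : (0 : ℝ) < n := by linarith
  have h4n : (0 : ℝ) < ((4 * n : ℕ) : ℝ) := by positivity
  have hle : (((4 * n : ℕ) : ℝ)) ≤ (n : ℝ) ^ (2 : ℝ) := by
    rw [Real.rpow_two]; push_cast; nlinarith
  have e1 : ((((4 * n : ℕ) : ℝ)) ^ (-(s / 4))) ^ 2 = (((4 * n : ℕ) : ℝ)) ^ (-(s / 2)) := by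
    rw [← Real.rpow_natCast, ← Real.rpow_mul h4n.le]
    congr 1; push_cast; ring
  have e2 : (n : ℝ) ^ (-s) = ((n : ℝ) ^ (2 : ℝ)) ^ (-(s / 2)) := by
    rw [← Real.rpow_mul hn0.le]
    congr 1; ring
  rw [e1, e2]
  exact Real.rpow_le_rpow_of_nonpos h4n hle (by linarith)

/-- **The reshape WEAKENS stub 2** (PROVED): the planner's scale-restricted criterion with
sub-polynomial threshold implies the registered blocking form at the tied scale — take `c₁` from
the criterion, apply `criticalExclusion` at `k = 4n` with `c = c₁(4n)`, pull the `k`-eventuality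
back along `n ↦ 4n`, and absorb `4^{-s/2}` with the rate at exponent `s/4` and `n ≥ 4`
(`rpow_neg_le_sq`). -/
theorem stub2_of_scaleRestrictedSlabCriterion (h : Stubs.scaleRestrictedSlabCriterion) :
    Stubs.stub_slabCriticalBlockingSubpoly := by
  obtain ⟨c₁, hrate, hFSC⟩ := h
  intro s hs
  have h4n : Tendsto (fun n : ℕ => 4 * n) atTop atTop :=
    tendsto_atTop_mono (fun n => show n ≤ 4 * n by omega) tendsto_id
  have hev : ∀ᶠ n : ℕ in atTop, (((4 * n : ℕ) : ℝ)) ^ (-(s / 4)) ≤ c₁ (4 * n) :=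
    h4n.eventually (hrate (s / 4) (by linarith))
  filter_upwards [hev, eventually_ge_atTop 4] with n hn hn4
  have hn1 : 1 ≤ n := le_trans (by norm_num) hn4
  have hA : (μS (4 * n) (pcSlab (4 * n))).real (slabCross (4 * n) n) ≤ 1 - c₁ (4 * n) :=
    criticalExclusion (4 * n) n (c₁ (4 * n)) (fun p hp => hFSC (4 * n) n p hn1 le_rfl hp)
  have hB : c₁ (4 * n) ≤ (μS (4 * n) (pcSlab (4 * n))).real (slabCross (4 * n) n)ᶜ := by
    rw [probReal_compl_eq_one_sub (measurableSet_slabCross (4 * n) n)]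
    linarith
  have hsq : ((((4 * n : ℕ) : ℝ)) ^ (-(s / 4))) ^ 2 = (((4 * n : ℕ) : ℝ)) ^ (-(s / 2)) := by
    rw [← Real.rpow_natCast, ← Real.rpow_mul (by positivity)]
    congr 1; push_cast; ring
  have hs2 : (((4 * n : ℕ) : ℝ)) ^ (-(s / 2)) ≤ (n : ℝ) ^ (-(s / 4) * 2) := by
    have hn0 : (0 : ℝ) < n := by exact_mod_cast (lt_of_lt_of_le (by norm_num) hn4)
    have : (n : ℝ) ≤ ((4 * n : ℕ) : ℝ) := by exact_mod_cast (show n ≤ 4 * n by omega)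
    calc (((4 * n : ℕ) : ℝ)) ^ (-(s / 2)) ≤ (n : ℝ) ^ (-(s / 2)) :=
          Real.rpow_le_rpow_of_nonpos hn0 this (by linarith)
      _ = (n : ℝ) ^ (-(s / 4) * 2) := by congr 1; ring
  calc (n : ℝ) ^ (-s) ≤ ((((4 * n : ℕ) : ℝ)) ^ (-(s / 4))) ^ 2 := rpow_neg_le_sq hs hn4
    _ ≤ c₁ (4 * n) := by
        -- `(4n)^{-s/2} ≤ (4n)^{-s/4} ≤ c₁(4n)` since `(4n)^{-s/4} ≤ 1`
        rw [hsq]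
        refine le_trans ?_ hn
        have h1 : (1 : ℝ) ≤ ((4 * n : ℕ) : ℝ) := by exact_mod_cast (show 1 ≤ 4 * n by omega)
        exact Real.rpow_le_rpow_of_exponent_le h1 (by linarith)
    _ ≤ (μS (4 * n) (pcSlab (4 * n))).real (slabCross (4 * n) n)ᶜ := hB

/-- Exponent bookkeeping: `n^{-s} = (n^{-(s/2)})²` for `n ≥ 1`. -/
theorem rpow_neg_eq_sq {s : ℝ} {n : ℕ} (hn : 1 ≤ n) :
    (n : ℝ) ^ (-s) = ((n : ℝ) ^ (-(s / 2))) ^ 2 := by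
  have hn0 : (0 : ℝ) ≤ n := by positivity
  rw [← Real.rpow_natCast, ← Real.rpow_mul hn0]
  congr 1; push_cast; ring

/-- **`SubpolynomialBlocking` from the two stub `Prop`s** (kernel-checked, no `sorry`; concludes
the crux BY NAME): for `s > 0` and `n` large,
`n^{-s} = (n^{-s/2})² ≤ P^{S_{4n}}_{p_c(S_{4n})}(blocked)² = P_{p_c(S_{4n})}(curtain0 n)²`
(stub 2 at exponent `s/2`; stub 1) `≤ P_{p_c}(curtain0 n)²` (`curtain_antitone`, `pc_le_pcSlab`:
the one place where `p ≤ p_c` is consumed) `≤ u_n` (`curtain_sq_le_block`). -/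
theorem SubpolynomialBlocking_of (h1 : Stubs.stub_slabTransfer)
    (h2 : Stubs.stub_slabCriticalBlockingSubpoly) :
    Theses.PercNonProliferation.SubpolynomialBlocking := by
  intro s hs
  filter_upwards [h2 (s / 2) (by linarith), eventually_ge_atTop 1] with n hn hn1
  have hC : (n : ℝ) ^ (-(s / 2)) ≤ (μ (pcSlab (4 * n))).real (curtain0 n) := by
    rw [h1 (pcSlab (4 * n)) n]; exact hn
  have hD : (n : ℝ) ^ (-(s / 2)) ≤ (μ (criticalProbI 3)).real (curtain0 n) :=
    hC.trans (curtain_antitone n (pc_le_pcSlab (4 * n)))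
  calc (n : ℝ) ^ (-s) = ((n : ℝ) ^ (-(s / 2))) ^ 2 := rpow_neg_eq_sq hn1
    _ ≤ ((μ (criticalProbI 3)).real (curtain0 n)) ^ 2 :=
        pow_le_pow_left₀ (Real.rpow_nonneg (by positivity) _) hD 2
    _ ≤ (μ (criticalProbI 3)).real (blockEv n) := curtain_sq_le_block (criticalProbI 3) n

/-- The `⇐` half of stub 3 is already in this file (documentation of the cut: the curtain bound at
`p = p_c` alone gives the crux; stub 2 asserts it at `p_c(S_{4n}) ≥ p_c`). -/
theorem crux_of_curtainSubpoly
    (h : ∀ s : ℝ, 0 < s → ∀ᶠ n : ℕ in atTop, (n : ℝ) ^ (-s) ≤ (μ (criticalProbI 3)).real (curtain0 n)) :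
    Theses.PercNonProliferation.SubpolynomialBlocking := by
  intro s hs
  filter_upwards [h (s / 2) (by linarith), eventually_ge_atTop 1] with n hn hn1
  calc (n : ℝ) ^ (-s) = ((n : ℝ) ^ (-(s / 2))) ^ 2 := rpow_neg_eq_sq hn1
    _ ≤ ((μ (criticalProbI 3)).real (curtain0 n)) ^ 2 :=
        pow_le_pow_left₀ (Real.rpow_nonneg (by positivity) _) hn 2
    _ ≤ (μ (criticalProbI 3)).real (blockEv n) := curtain_sq_le_block (criticalProbI 3) n

/-- Stub 2 together with stub 1 gives the curtain bound at `p_c` (the right-hand side of stub 3),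
so under stub 3 the line's open content is EXACTLY "stub 2 minus the crux" = the monotone climb. -/
theorem curtainSubpoly_of_stubs (h1 : Stubs.stub_slabTransfer)
    (h2 : Stubs.stub_slabCriticalBlockingSubpoly) :
    ∀ s : ℝ, 0 < s → ∀ᶠ n : ℕ in atTop, (n : ℝ) ^ (-s) ≤ (μ (criticalProbI 3)).real (curtain0 n) := by
  intro s hs
  filter_upwards [h2 s hs] with n hn
  have hC : (n : ℝ) ^ (-s) ≤ (μ (pcSlab (4 * n))).real (curtain0 n) := by
    rw [h1 (pcSlab (4 * n)) n]; exact hn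
  exact hC.trans (curtain_antitone n (pc_le_pcSlab (4 * n)))

/-- **The skeleton IS the crux proof once the sorries of stubs 1–2 are discharged** (D-0027 §3.3;
the application type-checks by unfolding the spelled-out signatures to the `Stubs.stub_*` `Prop`s). -/
theorem SubpolynomialBlocking_proof : Theses.PercNonProliferation.SubpolynomialBlocking :=
  SubpolynomialBlocking_of stub_slabTransfer stub_slabCriticalBlockingSubpoly

/-- Stub 3 by name (type-check of the spelled-out signature against `Stubs.stub_cruxIffCurtainSubpoly`). -/
theorem stub_cruxIffCurtainSubpoly' : Stubs.stub_cruxIffCurtainSubpoly := stub_cruxIffCurtainSubpoly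

/-! ## Consistency with the landed Negative lemmas (documentation theorems) -/

/-- Our `blockEv` is the Negative files' `(annulusCrossing 3 n)ᶜ`, so `u_n = blockProb 3 p n`. -/
theorem real_blockEv_eq_blockProb (p : unitInterval) (n : ℕ) :
    (μ p).real (blockEv n) =
      Theorems.SubpolynomialBlocking.Negative.blockProb 3 p n := rfl

/-- Calibration against `Negative.Strengthenings.blockProb_lt_one`: whatever threshold validates
the criterion at `k = 4n` is `< 1` in square — the stub set cannot overshoot (`c₁(4n)² ≤ u_n < 1`). -/
theorem threshold_sq_lt_one (h2 : Stubs.stub_slabTransfer) (n : ℕ) {c : ℝ} (hc : 0 ≤ c)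
    (hFSC : ∀ p : unitInterval, 1 - c < (μS (4 * n) p).real (slabCross (4 * n) n) →
      0 < theta (slabGraph 3 (4 * n)) (slabOrigin 3 (4 * n)) p) :
    c ^ 2 < 1 :=
  lt_of_le_of_lt (ladder h2 n hc hFSC)
    (by rw [real_blockEv_eq_blockProb]
        exact Theorems.SubpolynomialBlocking.Negative.blockProb_criticalProb_three_lt_one n)

end Summit.CriticalPhenomena.PercolationContinuityZ3.Cruxes.SubpolynomialBlocking.SlabLadderTwoCurtains

end
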